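import Summits.ResolutionOfSingularities.ResolutionOfSingularities.Theorems.FrobeniusClosingPatchingRelPerfectDepthSepTargets
import Summits.ResolutionOfSingularities.ResolutionOfSingularities.Theorems.FrobeniusClosingPatchingRelPerfectDepthOneBlowupDimension
import Summits.ResolutionOfSingularities.ResolutionOfSingularities.Theorems.FrobeniusClosingPatchingRelPerfectDepthWeightedSeqJBookkeeping
import Literature.AlgebraicGeometry.Resolution.BlowupsIntegral
import Literature.AlgebraicGeometry.Resolution.NormalCrossingsStrictification
import Literature.AlgebraicGeometry.Resolution.RegularBlowup
import Literature.AlgebraicGeometry.Resolution.ExcellentBlowup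
import Literature.AlgebraicGeometry.Resolution.RegularCentreBlowupSeqIntegral
import Literature.AlgebraicGeometry.Resolution.ArithmeticalThreefoldsBlowupFormDimThree
import Literature.AlgebraicGeometry.Resolution.Principalization
import Literature.AlgebraicGeometry.Resolution.CartierDivisorControlledTransform
import Literature.AlgebraicGeometry.Resolution.NonPrincipalLocus
import HarnessLib

/-!
# Crux `PatchingRelPerfect` (stmt-ResolutionOfSingularities-16161), chain W5.2 — F6 stage 2 («separation»)
# Bookkeeping FEEDER along `IsSepSeq` (weight-one sequences with boundary, keyed on `𝔟`)

[OURS · L1 W5.2 · F6 · TargetsF6 v1.1 7001d3757fbb0aa3 · res-L1-w52-plan-1 g7 DEAL #5q / g8 OFFER 09:59:52Z + STEER 2 10:04:06Z (iv)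
«pv-021 … `…DepthSepSeqBookkeeping.lean`»]  Pure PROOFS, no definitions, no named facts; the `IsSepSeq` analogue of
`…DepthWeightedSeqJBookkeeping` (p516310):

* `IsSepSeq.isLocallyNoetherian` — the top is locally Noetherian over a locally Noetherian base;
* `IsSepSeq.hasSNC_boundaryOf` — the boundary of the exponent list `𝒟'` has simple normal crossings at the end if `boundaryOf 𝒟` has
  at the start (each centre is snc with the previous boundary: `HasSNCWith.hasSNC_transform` on the booked list);
* `IsSepSeq.isEffectiveCartier` — the state stays an effective Cartier divisor (weight-one controlled transform of a Cartier
  divisor containing the centre: (L-A) `IsBlowup.isEffectiveCartier_controlledTransform_of_le_pow`);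
* `IsSepSeq.flagState₃_top` — the stage-1 output clauses `FlagState₃ E 𝔟 ⊤` (integral · Noetherian · regular · excellent · dim 3 ·
  `𝔟 ≠ ⊥` · locally principal; the flag clause vacuous) persist through stage 2 (same bricks as `IsFlagSeq.flagState₃`, weight one);
* the one-step laws `comap_eq_comap_mul_controlledTransform_one` (`τ^*𝔟' = C𝒪 · τᶜ(𝔟',1)` for `𝔟' ≤ C`) and
  `comap_monomialIdeal_mul_comap_eq_of_sepStep` (`τ^*(monomialIdeal 𝒟') · C𝒪 = monomialIdeal (booked list)`, the trace of the X-side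
  law `N' = σ^*N · 𝓘_exc`; p516859 `comap_monomialIdeal_mul_pow_eq_monomialIdeal_append` at `k = 1`).

Consumers: the `SeparationBoundary₃` driver (res-L1-w52-stub-1) and `stepSepOne_holds` (res-D-pv-016).  AI-written; AI review is
weaker than expert review. Nothing here is a statement of the manuscript under review.

## References
* J. Kollár, *Lectures on Resolution of Singularities* (2007), Def. 3.25, 3.30.2. [Kollar2007]
* E. Bierstone, D. Grigoriev, P. Milman, J. Włodarczyk (2011), Def. 3.1.3, §3.2, §4 Step 2a. [BierstoneGrigorievMilmanWlodarczyk2011]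
-/

-- `Summit.<Summit>.<Sub>.Theorems` with `Sub = Summit` (single-conjunct summit, D-0017)
set_option linter.dupNamespace false

noncomputable section

open CategoryTheory CategoryTheory.Limits AlgebraicGeometry TopologicalSpace
open Literature.AlgebraicGeometry.Resolution
open Scheme.IdealSheafData

namespace Summit.ResolutionOfSingularities.ResolutionOfSingularities.Theorems.DepthTargets

universe u

/-- One weight-one step: the centre is non-zero (`𝔟' ≠ ⊥`, `𝔟' ≤ C`). [folklore] -/
theorem ne_bot_of_le_of_ne_bot {E : Scheme.{u}} {𝔟 C : E.IdealSheafData} (hne : 𝔟 ≠ ⊥) (hle : 𝔟 ≤ C) : C ≠ ⊥ :=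
  fun h => hne (le_bot_iff.mp (hle.trans h.le))

/-- The top of an `IsSepSeq` over a locally Noetherian scheme is locally Noetherian. [folklore] -/
theorem IsSepSeq.isLocallyNoetherian :
    ∀ {E' E : Scheme.{u}} {ρ : E' ⟶ E} {𝔟 : E.IdealSheafData} {𝒟 : List (E.IdealSheafData × ℕ)}
      {𝔟' : E'.IdealSheafData} {𝒟' : List (E'.IdealSheafData × ℕ)},
      IsSepSeq ρ 𝔟 𝒟 𝔟' 𝒟' → IsLocallyNoetherian E → IsLocallyNoetherian E'
  | _, _, _, _, _, _, _, .nil 𝔟 𝒟, hE => hE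
  | _, _, _, _, _, _, _, .cons τ ρ 𝔟 𝒟 𝔟' 𝒟' C h _ _ _ _ _ _ hτ, hE => by
    haveI := h.isLocallyNoetherian hE
    haveI : IsProper τ := hτ.isProper
    exact LocallyOfFiniteType.isLocallyNoetherian τ

/-- **The boundary of the exponent list has simple normal crossings at the end of an `IsSepSeq` if it has at the start**
(each centre has snc with the previous boundary; `HasSNCWith.hasSNC_transform` on the booked list).
[cite: Kollar2007, Def. 3.25] [cite: BierstoneGrigorievMilmanWlodarczyk2011, Def. 3.1.3 (2), (4)] -/
theorem IsSepSeq.hasSNC_boundaryOf :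
    ∀ {E' E : Scheme.{u}} {ρ : E' ⟶ E} {𝔟 : E.IdealSheafData} {𝒟 : List (E.IdealSheafData × ℕ)}
      {𝔟' : E'.IdealSheafData} {𝒟' : List (E'.IdealSheafData × ℕ)},
      IsSepSeq ρ 𝔟 𝒟 𝔟' 𝒟' → IsLocallyNoetherian E → HasSNC (boundaryOf 𝒟) → HasSNC (boundaryOf 𝒟')
  | _, _, _, _, _, _, _, .nil 𝔟 𝒟, _, h0 => h0
  | _, _, _, _, _, _, _, .cons τ ρ 𝔟 𝒟 𝔟' 𝒟' C h _ _ _ hsnc _ _ hτ, hE, _ => by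
    haveI := h.isLocallyNoetherian hE
    exact hasSNC_boundaryOf_map_strictTransform_append hsnc hτ _

/-- **The state stays an effective Cartier divisor along an `IsSepSeq`** (each weight-one step: `τ^*𝔟' = C𝒪 · τᶜ(𝔟',1)`, a
factor of an effective Cartier product; (L-A) `IsBlowup.isEffectiveCartier_controlledTransform_of_le_pow`). [cite: Kollar2007, 3.30.2] -/
theorem IsSepSeq.isEffectiveCartier :
    ∀ {E' E : Scheme.{u}} {ρ : E' ⟶ E} {𝔟 : E.IdealSheafData} {𝒟 : List (E.IdealSheafData × ℕ)}
      {𝔟' : E'.IdealSheafData} {𝒟' : List (E'.IdealSheafData × ℕ)},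
      IsSepSeq ρ 𝔟 𝒟 𝔟' 𝒟' → IsEffectiveCartier 𝔟 → IsEffectiveCartier 𝔟'
  | _, _, _, _, _, _, _, .nil 𝔟 𝒟, h0 => h0
  | _, _, _, _, _, _, _, .cons τ ρ 𝔟 𝒟 𝔟' 𝒟' C h _ _ hle _ _ _ hτ, h0 =>
    hτ.isEffectiveCartier_controlledTransform_of_le_pow (m := 1) (h.isEffectiveCartier h0)
      (by simpa only [pow_one] using hle)

/-- **The stage-1 bookkeeping clauses persist through stage 2**: `FlagState₃ E 𝔟 ⊤` (integral · Noetherian · regular · excellent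
· dim 3 · `𝔟 ≠ ⊥` · locally principal; the flag clause `𝔟 ≤ ⊤` being trivial) is transported along any `IsSepSeq` — the same
routine bricks as `IsFlagSeq.flagState₃`, at weight one. [cite: Kollar2007, 3.30.2] -/
theorem IsSepSeq.flagState₃_top :
    ∀ {E' E : Scheme.{u}} {ρ : E' ⟶ E} {𝔟 : E.IdealSheafData} {𝒟 : List (E.IdealSheafData × ℕ)}
      {𝔟' : E'.IdealSheafData} {𝒟' : List (E'.IdealSheafData × ℕ)},
      IsSepSeq ρ 𝔟 𝒟 𝔟' 𝒟' → FlagState₃ E 𝔟 ⊤ → FlagState₃ E' 𝔟' ⊤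
  | _, _, _, _, _, _, _, .nil 𝔟 𝒟, h => h
  | _, _, _, _, _, _, _, .cons τ ρ 𝔟 𝒟 𝔟' 𝒟' C h hC _ hle _ _ _ hτ, h0 => by
    obtain ⟨hint, hnoeth, hreg, hexc, hdim, hne, hlp, -⟩ := h.flagState₃_top h0
    haveI := hint
    haveI := hnoeth
    have hC0 : C ≠ ⊥ := ne_bot_of_le_of_ne_bot hne hle
    have hCsupp : C.support ≠ ⊤ := fun htop =>
      not_mem_support_genericPoint hC0 (by rw [htop]; trivial)
    have hcart : IsEffectiveCartier 𝔟' := hlp.isEffectiveCartier_of_ne_bot hne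
    have hle1 : 𝔟' ≤ C ^ 1 := by simpa only [pow_one] using hle
    refine ⟨hτ.isIntegral hC0, isNoetherian_of_isBlowup hτ, hτ.isRegular_of_isRegular_subscheme hreg hC,
      hτ.isExcellent hexc, DepthOne.topologicalKrullDim_eq_of_isBlowup hτ hC0 hdim, ?_, ?_, le_top⟩
    · exact fun h0' => hτ.comap_ne_bot hCsupp hne
        (le_bot_iff.mp ((comap_le_controlledTransform τ C 𝔟' 1).trans h0'.le))
    · exact (hτ.isEffectiveCartier_controlledTransform_of_le_pow hcart hle1).isLocallyPrincipal

/-- **The N-side monomial law of one `IsSepSeq` step, restricted form**: `τ^*(monomialIdeal 𝒟') · C𝒪 = monomialIdeal (booked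
list)` (the trace of the X-side law `N' = σ^*N · 𝓘_exc`; my p516859 `comap_monomialIdeal_mul_pow_eq_monomialIdeal_append` at
`k = 1`). [cite: BierstoneGrigorievMilmanWlodarczyk2011, §4 Step 2a] -/
theorem comap_monomialIdeal_mul_comap_eq_of_sepStep {E' E'' : Scheme.{u}} [IsLocallyNoetherian E'] {τ : E'' ⟶ E'}
    {C : E'.IdealSheafData} {𝒟' : List (E'.IdealSheafData × ℕ)}
    (hsnc : HasSNCWith (boundaryOf 𝒟') C) (hU : UniformPieces 𝒟' C [C.support]) (hτ : IsBlowup τ C) :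
    (monomialIdeal 𝒟').comap τ * C.comap τ =
      monomialIdeal ((𝒟'.map fun p => (strictTransformIdeal τ C p.1, p.2)) ++
        [(C.comap τ, weightOf 𝒟' (divisorsOver 𝒟' C C.support) + 1)]) := by
  simpa only [pow_one] using comap_monomialIdeal_mul_pow_eq_monomialIdeal_append hsnc hτ hU 1

/-- **One weight-one step of the state**: `τ^*𝔟' = C𝒪 · τᶜ(𝔟', 1)` for `𝔟' ≤ C` (`IsBlowup.comap_eq_pow_mul_controlledTransform_of_le_pow`
at `m = 1`). [cite: BierstoneGrigorievMilmanWlodarczyk2011, §3.2 Lemma 3.2.1] -/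
theorem comap_eq_comap_mul_controlledTransform_one {E' E'' : Scheme.{u}} {τ : E'' ⟶ E'} {C 𝔟' : E'.IdealSheafData}
    (hτ : IsBlowup τ C) (hle : 𝔟' ≤ C) : 𝔟'.comap τ = C.comap τ * controlledTransform τ C 𝔟' 1 := by
  have h := hτ.comap_eq_pow_mul_controlledTransform_of_le_pow (m := 1) (by simpa only [pow_one] using hle)
  simpa only [pow_one] using h

/- Clause projections (integral · Noetherian · regular · excellent · dim · ne_bot · locally principal) are read off
`IsSepSeq.flagState₃_top` as `(h.flagState₃_top h0).1`, `.2.1`, … (the gate's dedup identifies separately stated projections with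
the `IsFlagSeq` ones of `…DepthFlagSeqState`). -/



end Summit.ResolutionOfSingularities.ResolutionOfSingularities.Theorems.DepthTargets

end
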